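import Literature.Topology.FourManifolds.GompfTubeStraightening
import HarnessLib

/-!
# The tube shear as a global monodromy model

Infrastructure for the framed form of R. Gompf, *More Cappell–Shaneson spheres are standard*,
Algebr. Geom. Topol. 10 (2010), Thm 2.1 / §4 ¶3 (the named fact
`Literature.Topology.FourManifolds.gompf2010_framedTwist`, **F**). The assembly
`gompf2010_framedTwist_of_tubeShearModel` (`GompfFramedTwistOfTubeModel.lean`) needs Gompf's
fishtail twisting data for *one* monodromy `ψ₀` of `T³` which is the tube shear `tubeShear`
(`GompfTubeStraightening.lean`) on some tube about the first coordinate circle `α`. The simplest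
choice is the tube shear itself, which is a diffeomorphism of the whole torus: in the coordinates
`n = x + z`, `ℓ = z` it is `(n, y, ℓ) ↦ (n, y, ℓ + G(n))`, `e^{iG} = F = shearF`.

* `Literature.Topology.FourManifolds.contMDiff_shearF`, `Literature.Topology.FourManifolds.tubeShearDiffeo`
  — the tube shear as a diffeomorphism of `T³` (inverse `(z₁ F(z₁z₃), z₂, z₃ F(z₁z₃)⁻¹)`, the
  product `z₁ z₃ = e^{in}` being invariant);
* `Literature.Topology.FourManifolds.tubeShear_expT_of_norm_lt` — it is the identity on
  `expT (B(0, 1/2))` (there `|n| < 1`, so `F = 1`);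
* `Literature.Topology.FourManifolds.tubeShearDiffeo_eq_tubeShear` — the model hypothesis of the
  assembly, for any tube radius `r₁`.

Everything is proved; no named facts.

## References

* R. E. Gompf, *More Cappell–Shaneson spheres are standard*, Algebr. Geom. Topol. 10 (2010)
  1665–1681, Thm 2.1 (hypotheses on `α`, `φ(α)`, `T`) and §4 ¶3. [GompfAGT2010]
-/

noncomputable section

open scoped Manifold ContDiff Topology Real
open Set Function Complex

namespace Literature.Topology.FourManifolds

local notation "𝔼" n => EuclideanSpace ℝ (Fin n)
local notation "𝓣" =>
  (ModelWithCorners.prod (𝓡 1) (ModelWithCorners.prod (𝓡 1) (𝓡 1)))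

/-- The seam circle map `F` is smooth. [folklore] -/
theorem contMDiff_shearF : ContMDiff (𝓡 1) (𝓡 1) ∞ shearF := by
  have h : shearF = fun u ↦ u * shearFactor 1 u 1 := funext shearF_eq_mul_shearFactor
  rw [h]
  exact contMDiff_id.mul (contMDiff_shearFactor.comp
    (contMDiff_const.prodMk (contMDiff_id.prodMk contMDiff_const)))

/-- The inverse tube shear `(z₁ F(z₁z₃), z₂, z₃ F(z₁z₃)⁻¹)`. [folklore] -/
def tubeShearInv (z : ThreeTorus) : ThreeTorus :=
  (z.1 * shearF (z.1 * z.2.2), z.2.1, z.2.2 * (shearF (z.1 * z.2.2))⁻¹)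

/-- The product `z₁ z₃` is invariant under the tube shear. [folklore] -/
theorem tubeShear_fst_mul (z : ThreeTorus) : (tubeShear z).1 * (tubeShear z).2.2 = z.1 * z.2.2 := by
  simp only [tubeShear]
  rw [mul_mul_mul_comm, inv_mul_cancel, mul_one]

/-- The product `z₁ z₃` is invariant under the inverse tube shear. [folklore] -/
theorem tubeShearInv_fst_mul (z : ThreeTorus) : (tubeShearInv z).1 * (tubeShearInv z).2.2 = z.1 * z.2.2 := by
  simp only [tubeShearInv]
  rw [mul_mul_mul_comm, mul_inv_cancel, mul_one]

/-- `tubeShearInv ∘ tubeShear = id`. [folklore] -/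
theorem tubeShearInv_tubeShear (z : ThreeTorus) : tubeShearInv (tubeShear z) = z := by
  have h := tubeShear_fst_mul z
  obtain ⟨z₁, z₂, z₃⟩ := z
  simp only [tubeShearInv, h]
  simp [tubeShear]

/-- `tubeShear ∘ tubeShearInv = id`. [folklore] -/
theorem tubeShear_tubeShearInv (z : ThreeTorus) : tubeShear (tubeShearInv z) = z := by
  have h := tubeShearInv_fst_mul z
  obtain ⟨z₁, z₂, z₃⟩ := z
  simp only [tubeShear, h]
  simp [tubeShearInv]

/-- The tube shear is smooth. [folklore] -/
theorem contMDiff_tubeShear : ContMDiff 𝓣 𝓣 ∞ tubeShear := by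
  have hF : ContMDiff 𝓣 (𝓡 1) ∞ fun z : ThreeTorus ↦ shearF (z.1 * z.2.2) :=
    contMDiff_shearF.comp (contMDiff_fst.mul (contMDiff_snd.comp contMDiff_snd))
  exact (contMDiff_fst.mul hF.inv).prodMk ((contMDiff_fst.comp contMDiff_snd).prodMk
    ((contMDiff_snd.comp contMDiff_snd).mul hF))

/-- The inverse tube shear is smooth. [folklore] -/
theorem contMDiff_tubeShearInv : ContMDiff 𝓣 𝓣 ∞ tubeShearInv := by
  have hF : ContMDiff 𝓣 (𝓡 1) ∞ fun z : ThreeTorus ↦ shearF (z.1 * z.2.2) :=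
    contMDiff_shearF.comp (contMDiff_fst.mul (contMDiff_snd.comp contMDiff_snd))
  exact (contMDiff_fst.mul hF).prodMk ((contMDiff_fst.comp contMDiff_snd).prodMk
    ((contMDiff_snd.comp contMDiff_snd).mul hF.inv))

/-- **The tube shear as a diffeomorphism of `T³`** — the model monodromy `ψ₀`. [cite: GompfAGT2010, Thm 2.1 (hypotheses: α, φ(α) ⊂ T meeting in an arc)] -/
def tubeShearDiffeo : ThreeTorus ≃ₘ⟮𝓣, 𝓣⟯ ThreeTorus where
  toFun := tubeShear
  invFun := tubeShearInv
  left_inv := tubeShearInv_tubeShear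
  right_inv := tubeShear_tubeShearInv
  contMDiff_toFun := contMDiff_tubeShear
  contMDiff_invFun := contMDiff_tubeShearInv

/-- The underlying map of `tubeShearDiffeo`. [folklore] -/
@[simp] theorem coe_tubeShearDiffeo : ⇑tubeShearDiffeo = tubeShear := rfl

/-- **The model hypothesis of the assembly**: `ψ₀ = tubeShear` on every tube (indeed everywhere). [folklore] -/
theorem tubeShearDiffeo_eq_tubeShear (r₁ : ℝ) :
    ∀ z : ThreeTorus, |arg (z.2.1 : ℂ)| < r₁ → |arg (z.2.2 : ℂ)| < r₁ → tubeShearDiffeo z = tubeShear z :=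
  fun _ _ _ ↦ rfl

/-- **The tube shear is the identity on `expT (B(0, 1/2))`**: there `n = v₀ + v₂` has `|n| < 1`,
so `F(e^{in}) = 1`. [folklore] -/
theorem tubeShear_expT_of_norm_lt {v : 𝔼 3} (hv : ‖v‖ < 1 / 2) : tubeShear (expT v) = expT v := by
  refine tubeShear_eq_self ?_
  have h0 : |v 0| < 1 / 2 := lt_of_le_of_lt ((Real.norm_eq_abs _).symm.le.trans (PiLp.norm_apply_le v 0)) hv
  have h2 : |v 2| < 1 / 2 := lt_of_le_of_lt ((Real.norm_eq_abs _).symm.le.trans (PiLp.norm_apply_le v 2)) hv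
  have hn : |v 0 + v 2| < 1 := by
    have := abs_add_le (v 0) (v 2); linarith
  have hprod : (expT v).1 * (expT v).2.2 = Circle.exp (v 0 + v 2) := by
    simp [expT, Circle.exp_add]
  rw [hprod]
  refine shearF_eq_one_of_arg_le_one ?_
  have hπ := Real.pi_gt_three
  rw [Circle.arg_exp (by linarith [(abs_lt.1 hn).1]) (by linarith [(abs_lt.1 hn).2])]
  linarith [(abs_lt.1 hn).2]

end Literature.Topology.FourManifolds
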